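import Summits.CriticalPhenomena.SAWScalingLimit.Theses.SAWRenewalTightness
import Summits.CriticalPhenomena.SAWScalingLimit.Theorems.SAWRenewalTightnessEventualTightAspectReduction
import Literature.Probability.RandomPlanarGeometry.SAWSideProbability
import Literature.Probability.RandomPlanarGeometry.CurveTortuosity

/-!
# Crux idea `dive-ratio-monotone` for `BulkShellTight` (stmt-CriticalPhenomena-17588) — first lemma

Ideator planner-cruxidea-stmt-CriticalPhenomena-17588-2-0 (round 1, k = 2).

`u_m(δ)` := probability (critical SAW law of `Ω_δ` from `a_δ` to `b_δ`) that the SAW polyline makes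
`2m` separate traversals ("`m` dives") of a fixed interior shell.

* `RatioMonotone`  — STRUCTURAL (sign) hypothesis, no constant: from the first dive on the ratios
  `u_{m+1}/u_m` are non-increasing, i.e. `u_{m+2} · u_m ≤ u_{m+1}²` (tail log-concavity in the
  strand number), eventually in `δ` (threshold may depend on `m`), asked ONLY on aspect-two shells
  `D(y; η, 2η)` with collar `B̄(y, 4η) ⊆ Ω` (the landed aspect reduction p143627 does the rest; any
  larger aspect would do by the same net argument).
* `SecondDiveSeed` — ONE positivity input of restriction type on the same shells: among walks that
  dive once a positive fraction do not dive twice, `u_2 ≤ (1 - c) u_1` eventually.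

`bulkShellTight_of_ratioMonotone : RatioMonotone → SecondDiveSeed → BulkShellTight` — PROVED
(the ratios telescope to `u_{m+1} ≤ (1-c)^m` on aspect-two shells; then `Theorems.stub_aspectReduction`).
-/

namespace Summit.CriticalPhenomena.SAWScalingLimit.Cruxes.BulkShellTight.DiveRatio

open MeasureTheory Set Metric
open Literature.Probability.RandomPlanarGeometry Literature.Probability.LatticeModels
open scoped ENNReal

/-- `u_m(δ)`: the probability of `2m` separate traversals ("`m` dives") of the shell `D(y; η, R)`. -/
noncomputable def diveProb (D : DobrushinDomain) (a b : ℝ → Site 2) (y : ℂ) (η R : ℝ) (δ : ℝ)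
    (m : ℕ) : ℝ≥0∞ :=
  SAW.law D.carrier δ (a δ) (b δ)
    {γ | (⟨γ.walk.toCurve (meshPoint δ)⟩ : Curve ℂ).HasTraversals (2 * m) y η R}

/-- **RatioMonotone** (structural conjecture, fugacity-insensitive in intent), asked on aspect-two
interior shells only: for every Dobrushin datum with an endpoint approximation, every `y, η` with
`B̄(y, 4η) ⊆ Ω` and every `m ≥ 1`, eventually in `δ`,
`u_{m+2}(δ) · u_m(δ) ≤ u_{m+1}(δ)²` for the shell `D(y; η, 2η)`. -/
def RatioMonotone : Prop :=
  ∀ (D : DobrushinDomain) (a b : ℝ → Site 2), SAW.IsEndpointApprox D a b →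
    ∀ (y : ℂ) (η : ℝ), 0 < η → closedBall y (4 * η) ⊆ D.carrier →
      ∀ m : ℕ, 1 ≤ m → ∃ δ₁ : ℝ, 0 < δ₁ ∧ ∀ δ ∈ Set.Ioc (0 : ℝ) δ₁,
        diveProb D a b y η (2 * η) δ (m + 2) * diveProb D a b y η (2 * η) δ m ≤
          diveProb D a b y η (2 * η) δ (m + 1) ^ 2

/-- **SecondDiveSeed** (restriction-type positivity) on the same shells: eventually in `δ`,
`u_2 ≤ (1 - c) · u_1` with `c > 0` depending on the datum and the shell only. -/
def SecondDiveSeed : Prop :=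
  ∀ (D : DobrushinDomain) (a b : ℝ → Site 2), SAW.IsEndpointApprox D a b →
    ∀ (y : ℂ) (η : ℝ), 0 < η → closedBall y (4 * η) ⊆ D.carrier →
      ∃ c δ₁ : ℝ, 0 < c ∧ c ≤ 1 ∧ 0 < δ₁ ∧ ∀ δ ∈ Set.Ioc (0 : ℝ) δ₁,
        diveProb D a b y η (2 * η) δ 2 ≤ ENNReal.ofReal (1 - c) * diveProb D a b y η (2 * η) δ 1

theorem diveProb_le_one (D : DobrushinDomain) (a b : ℝ → Site 2) (y : ℂ) (η R δ : ℝ) (m : ℕ) :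
    diveProb D a b y η R δ m ≤ 1 :=
  SAW.law_apply_le_one _ _ _ _ _

theorem diveProb_antitone (D : DobrushinDomain) (a b : ℝ → Site 2) (y : ℂ) (η R δ : ℝ) {m m' : ℕ}
    (h : m ≤ m') : diveProb D a b y η R δ m' ≤ diveProb D a b y η R δ m := by
  unfold diveProb
  refine measure_mono ?_
  intro γ hγ
  exact Curve.HasTraversals.of_le hγ (by omega)

/-- One induction step: ratio monotonicity propagates the bound `u_{n+1} ≤ q u_n` to `u_{n+2} ≤ q u_{n+1}`. -/
theorem step {u : ℕ → ℝ≥0∞} {q : ℝ≥0∞} {n : ℕ} (hle : ∀ m, u m ≤ 1)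
    (hanti : ∀ {m m'}, m ≤ m' → u m' ≤ u m)
    (hmono : u (n + 2) * u n ≤ u (n + 1) ^ 2) (hn : u (n + 1) ≤ q * u n) :
    u (n + 2) ≤ q * u (n + 1) := by
  by_cases h0 : u n = 0
  · have h1 : u (n + 1) = 0 := le_antisymm (by simpa [h0] using hn) zero_le
    have h2 : u (n + 2) ≤ u (n + 1) := hanti (by omega)
    rw [h1] at h2 ⊢
    exact (le_antisymm h2 zero_le).le.trans zero_le
  · have htop : u n ≠ ⊤ := ne_top_of_le_ne_top ENNReal.one_ne_top (hle n)
    have : u (n + 2) * u n ≤ (q * u (n + 1)) * u n := by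
      calc u (n + 2) * u n ≤ u (n + 1) ^ 2 := hmono
        _ = u (n + 1) * u (n + 1) := sq _
        _ ≤ u (n + 1) * (q * u n) := mul_le_mul_right hn _
        _ = (q * u (n + 1)) * u n := by ring
    exact (ENNReal.mul_le_mul_iff_left h0 htop).1 this

/-- **Core real-sequence lemma.** A `δ`-indexed family of sequences `u δ : ℕ → ℝ≥0∞` that is bounded by
`1`, antitone in the index, eventually ratio-monotone at every level `m ≥ 1` and eventually seeded at level
`1` by `q = 1 - c < 1`, is eventually below any `ε > 0` at a level depending only on `(c, ε)`. -/
theorem eventually_small_of_ratio {u : ℝ → ℕ → ℝ≥0∞} {c : ℝ} (hc : 0 < c) (hc1 : c ≤ 1)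
    (hle : ∀ δ m, u δ m ≤ 1) (hanti : ∀ δ {m m'}, m ≤ m' → u δ m' ≤ u δ m)
    (hR : ∀ m : ℕ, 1 ≤ m → ∃ δ₁ : ℝ, 0 < δ₁ ∧ ∀ δ ∈ Set.Ioc (0 : ℝ) δ₁,
      u δ (m + 2) * u δ m ≤ u δ (m + 1) ^ 2)
    (hS : ∃ δ₁ : ℝ, 0 < δ₁ ∧ ∀ δ ∈ Set.Ioc (0 : ℝ) δ₁, u δ 2 ≤ ENNReal.ofReal (1 - c) * u δ 1)
    {ε : ℝ} (hε : 0 < ε) :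
    ∃ (m₀ : ℕ) (δ₁ : ℝ), 0 < δ₁ ∧ ∀ δ ∈ Set.Ioc (0 : ℝ) δ₁, u δ (m₀ + 1) ≤ ENNReal.ofReal ε := by
  obtain ⟨δs, hδs, hseed⟩ := hS
  set q : ℝ≥0∞ := ENNReal.ofReal (1 - c) with hq
  -- eventually in δ, all ratios up to level n are ≤ q
  have key : ∀ n : ℕ, 1 ≤ n → ∃ δ₁ : ℝ, 0 < δ₁ ∧ ∀ δ ∈ Set.Ioc (0 : ℝ) δ₁,
      ∀ i, 1 ≤ i → i ≤ n → u δ (i + 1) ≤ q * u δ i := by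
    intro n hn
    induction n with
    | zero => exact absurd hn (by omega)
    | succ n ih =>
      by_cases hn0 : n = 0
      · subst hn0
        refine ⟨δs, hδs, fun δ hδ i hi1 hi2 => ?_⟩
        have : i = 1 := by omega
        subst this
        simpa [hq] using hseed δ hδ
      · obtain ⟨δ₁, hδ₁, h₁⟩ := ih (by omega)
        obtain ⟨δ₂, hδ₂, h₂⟩ := hR n (by omega)
        refine ⟨min δ₁ δ₂, lt_min hδ₁ hδ₂, fun δ hδ i hi1 hi2 => ?_⟩
        have hδ1 : δ ∈ Set.Ioc (0 : ℝ) δ₁ := ⟨hδ.1, hδ.2.trans (min_le_left _ _)⟩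
        have hδ2 : δ ∈ Set.Ioc (0 : ℝ) δ₂ := ⟨hδ.1, hδ.2.trans (min_le_right _ _)⟩
        by_cases hin : i ≤ n
        · exact h₁ δ hδ1 i hi1 hin
        · have : i = n + 1 := by omega
          subst this
          have hprev : u δ (n + 1) ≤ q * u δ n := h₁ δ hδ1 n (by omega) le_rfl
          exact step (hle δ) (fun {m m'} h => hanti δ h) (h₂ δ hδ2) hprev
  have hq1 : (1 - c) < 1 := by linarith
  have hq0 : 0 ≤ (1 - c) := by linarith
  obtain ⟨m₀, hm₀⟩ := exists_pow_lt_of_lt_one hε hq1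
  obtain ⟨δ₁, hδ₁, hrat⟩ := key (m₀ + 1) (by omega)
  refine ⟨m₀, δ₁, hδ₁, fun δ hδ => ?_⟩
  have geom : ∀ k, k ≤ m₀ → u δ (k + 1) ≤ q ^ k := by
    intro k hk
    induction k with
    | zero => simpa using hle δ 1
    | succ k ih =>
      calc u δ (k + 1 + 1) ≤ q * u δ (k + 1) := hrat δ hδ (k + 1) (by omega) (by omega)
        _ ≤ q * q ^ k := mul_le_mul_right (ih (by omega)) _
        _ = q ^ (k + 1) := by ring
  calc u δ (m₀ + 1) ≤ q ^ m₀ := geom m₀ le_rfl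
    _ = ENNReal.ofReal ((1 - c) ^ m₀) := by rw [hq, ENNReal.ofReal_pow hq0]
    _ ≤ ENNReal.ofReal ε := ENNReal.ofReal_le_ofReal hm₀.le

/-- The aspect-two bulk statement (verbatim the hypothesis of the landed `Theorems.stub_aspectReduction`)
from ratio monotonicity and the seed. -/
theorem bulkShellTightAtAspectTwo_of_ratioMonotone (hR : RatioMonotone) (hS : SecondDiveSeed) :
    ∀ (D : DobrushinDomain) (a b : ℝ → Site 2), SAW.IsEndpointApprox D a b →
      ∀ (y : ℂ) (η : ℝ), 0 < η → Metric.closedBall y (4 * η) ⊆ D.carrier →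
        ∀ ε : ℝ, 0 < ε → ∃ (j : ℕ) (δ₁ : ℝ), 0 < δ₁ ∧ ∀ δ ∈ Set.Ioc (0 : ℝ) δ₁,
          SAW.law D.carrier δ (a δ) (b δ)
            {γ | (⟨γ.walk.toCurve (meshPoint δ)⟩ : Curve ℂ).HasTraversals j y η (2 * η)} ≤
              ENNReal.ofReal ε := by
  intro D a b hab y η hη hcoll ε hε
  obtain ⟨c, δs, hc, hc1, hδs, hseed⟩ := hS D a b hab y η hη hcoll
  obtain ⟨m₀, δ₁, hδ₁, h⟩ := eventually_small_of_ratio (u := fun δ m => diveProb D a b y η (2 * η) δ m)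
    hc hc1 (fun δ m => diveProb_le_one D a b y η (2 * η) δ m)
    (fun δ {m m'} hmm => diveProb_antitone D a b y η (2 * η) δ hmm)
    (hR D a b hab y η hη hcoll) ⟨δs, hδs, hseed⟩ hε
  exact ⟨2 * (m₀ + 1), δ₁, hδ₁, fun δ hδ => by simpa [diveProb] using h δ hδ⟩

/-- **First lemma (PROVED): ratio monotonicity from the first dive on, plus one positivity seed, both on
aspect-two interior shells only, give per-shell tightness of the traversal count on every interior shell —
the crux `BulkShellTight` verbatim (via the landed aspect reduction p143627).** -/
theorem bulkShellTight_of_ratioMonotone (hR : RatioMonotone) (hS : SecondDiveSeed) :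
    Summit.CriticalPhenomena.SAWScalingLimit.Theses.SAWRenewalTightness.BulkShellTight :=
  Summit.CriticalPhenomena.SAWScalingLimit.Theorems.stub_aspectReduction
    (bulkShellTightAtAspectTwo_of_ratioMonotone hR hS)

end Summit.CriticalPhenomena.SAWScalingLimit.Cruxes.BulkShellTight.DiveRatio
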